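import Summits.RiemannHypothesis.RiemannHypothesis.Theorems.Splittings.RobinFiniteThetaRelWindow2
import HarnessLib

/-!
# RobinFiniteThetaRelMain — gen 13 θ-CEILING LIFT, part 3/6 (R1b₃–R1c): `G_large2R` and the main estimate with NO `θ`-hypothesis

Cell rh-split, seat rh-split-robin-finite g13 (card `cards/SPLIT-robin-finite.md` §20, «θ-CEILING LIFT WITH NO NEW INPUT»).
A use-site audit of the tree's exchange engine shows that above the `Q`-scale every `θ`-evaluation consumes only RELATIVE precision
— RH-free from the two named facts the engine already carries, Büthe 2018 Thm 2 (`x ≤ 10¹⁹`) and BKLNW 2021 §1.2 (`x ≥ 10¹⁹`) — except the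
E-side term `S²(x) = (θ(x) − x)²/(x² log x)`, which BKLNW bounds by `1.43641·10⁻⁹/log⁵x`.  Parts 1–6 re-read the engine accordingly: above
`2.5·10²²` NO Schoenfeld-form window, NO Büthe 2016, NO range condition `4.92·√(X/log X) ≤ T`; RH to height `T` enters only through the
zero side, and the budget acquires the `T`-independent S²-price `2.07·10⁻¹⁶·√X` (BKLNW ceiling `X ≲ 5.5·10³⁰`).

This part (0 `def`): `G_large2R` (the tree's `G_large2W` re-read RH-free: for `2·10¹⁹ ≤ P`, `Q ≤ P`, `L₁ ≤ log P`, `45 ≤ L₁`, `c ≤ 2.58`,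
`6.58·(c − 2.042) ≤ 0.042·L₁`: `c/(√P log P) ≤ S + G`) and `mertens_prod_lt_ofR` (the tree's `mertens_prod_lt_of` with the `θ`-block replaced by
`one_lt_theta`: no `θ`-hypothesis at all).

HONEST LABEL: SPLITTING SEARCH over kernel-typed RH-EQUIVALENCES; a splitting A ∧ B ⟹ RH is CONDITIONAL
bookkeeping unless A and B are both proved; nothing here bears on the truth of RH.
-/

set_option linter.dupNamespace false

noncomputable section

namespace Summit.RiemannHypothesis.RiemannHypothesis.Theorems.Splittings.RobinFiniteE3

open Real Filter Finset
open scoped Chebyshev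
open Literature.NumberTheory.LFunctions Literature.NumberTheory.DiophantineGeometry
open RobinAnalyticSharp

section LargePRel
open RobinAnalytic

/-- R1 · **`G_large2W` re-read RH-free (gen 13; no window, no `B`): `S + G ≥ c/(√P log P)` for `2·10¹⁹ ≤ P`, `Q ≤ P`**, for every `c` with `c ≤ 2.9` (Case A) and
`c² ≤ 4·0.99925·s(L₁)` (Case C, AM–GM of `0.99925·q + s(L₁)/q`, `q = Q/√P`), `L₁ ≤ log P`; Case B (`Q ≤ √P/4`) by
`window_caseBR` (`5.8`).  The `θ`-inputs are Büthe 2018 Thm 2 and BKLNW 2021 §1.2 ONLY (hypotheses). -/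
theorem G_large2R (h18 : Buthe2018_thm2_theta) (h21 : BroadbentEtAl2021_theta_rel_1e19) {P Q : ℕ}
    (hP : (2 * 10 ^ 19 : ℝ) ≤ P) (hQP : Q ≤ P) {L₁ c : ℝ} (hL₁ : L₁ ≤ Real.log P) (hL₁0 : 0 < L₁)
    (hcA : c ≤ 2.9)
    (hcC : c ^ 2 ≤ 4 * 0.99925 * (1.8018 * L₁ / (L₁ + 9.6567) + 0.18488 * L₁ / (L₁ + 15.6481))) :
    c / (√(P : ℝ) * Real.log P) ≤
      ∑ p ∈ (Nat.primesLE P).filter (fun p => Q < p), ((p : ℝ) ^ 2)⁻¹ +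
        θ Q / ((θ P + θ Q) * Real.log (θ P + θ Q)) := by
  have hP10 := P_ge_2e10_of19 hP
  have hL := logP_ge19 hP
  have hsP := sqrtP_ge19 hP
  have hsq := sq_sqrtP hP10
  have hP0 := P_pos hP10
  obtain ⟨hθP1, hθP2⟩ := thetaP_boundsR h18 h21 hP10
  have hden : 0 < √(P : ℝ) * Real.log P := by positivity
  set S := ∑ p ∈ (Nat.primesLE P).filter (fun p => Q < p), ((p : ℝ) ^ 2)⁻¹ with hSdef
  set G := θ Q / ((θ P + θ Q) * Real.log (θ P + θ Q)) with hGdef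
  have hS0 : 0 ≤ S := Finset.sum_nonneg fun p _ => by positivity
  have hG0 : 0 ≤ G := by
    have h1 : 0 ≤ θ Q := Chebyshev.theta_nonneg _
    have h2 : 1 < θ P + θ Q := by nlinarith
    have h3 : 0 < Real.log (θ P + θ Q) := Real.log_pos h2
    positivity
  have hcB : c ≤ 5.8 := by linarith
  rcases le_or_gt (6 * √(P : ℝ)) Q with hA | hA
  · -- Case A
    have := gain_caseA6R h18 h21 hP hQP hA
    have h2 : c / (√(P : ℝ) * Real.log P) ≤ 2.9 / (√(P : ℝ) * Real.log P) :=
      div_le_div_of_nonneg_right hcA hden.le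
    linarith
  rcases le_or_gt (Q : ℝ) (√(P : ℝ) / 4) with hQ4 | hQ4
  · -- Case B
    have := window_caseBR h18 h21 hP10 hQ4
    have h2 : c / (√(P : ℝ) * Real.log P) ≤ 5.8 / (√(P : ℝ) * Real.log P) :=
      div_le_div_of_nonneg_right hcB hden.le
    linarith
  · -- Case C
    have h1 := gain_caseC6R h18 h21 hP hQ4 hA
    have h2 := window_caseC6R h18 h21 hP hQ4 hA hL₁ hL₁0
    set s := 1.8018 * L₁ / (L₁ + 9.6567) + 0.18488 * L₁ / (L₁ + 15.6481) with hs
    have hs0 : 0 ≤ s := by positivity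
    have hQ0 : (0 : ℝ) < Q := by
      have : (0 : ℝ) < √(P : ℝ) / 4 := by positivity
      linarith
    have hLpos : 0 < Real.log P := by linarith
    have hr0 : 0 < √(P : ℝ) := by linarith
    -- the quadratic form `0.99925 Q² − c Q √P + s √P² ≥ 0` from `c² ≤ 4·0.99925·s`
    have hquad : 0 ≤ 0.99925 * (Q : ℝ) ^ 2 - c * Q * √(P : ℝ) + s * √(P : ℝ) ^ 2 := by
      have e : 0.99925 * (Q : ℝ) ^ 2 - c * Q * √(P : ℝ) + s * √(P : ℝ) ^ 2 =
          0.99925 * ((Q : ℝ) - c / (2 * 0.99925) * √(P : ℝ)) ^ 2 +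
            (s - c ^ 2 / (4 * 0.99925)) * √(P : ℝ) ^ 2 := by ring
      rw [e]
      have h4 : 0 ≤ s - c ^ 2 / (4 * 0.99925) := by
        rw [sub_nonneg, div_le_iff₀ (by norm_num)]; linarith
      positivity
    have hid : (0.99925 * (Q : ℝ) ^ 2 + s * P) * √(P : ℝ) - c * P * Q =
        √(P : ℝ) * (0.99925 * (Q : ℝ) ^ 2 - c * Q * √(P : ℝ) + s * √(P : ℝ) ^ 2) := by
      linear_combination (c * (Q : ℝ) - s * √(P : ℝ)) * hsq
    have hnum : c * (P : ℝ) * Q ≤ (0.99925 * (Q : ℝ) ^ 2 + s * P) * √(P : ℝ) := by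
      nlinarith [mul_nonneg hr0.le hquad]
    have key : c / (√(P : ℝ) * Real.log P) ≤
        0.99925 * Q / ((P : ℝ) * Real.log P) + s / ((Q : ℝ) * Real.log P) := by
      have e1 : 0.99925 * Q / ((P : ℝ) * Real.log P) + s / ((Q : ℝ) * Real.log P) =
          (0.99925 * (Q : ℝ) ^ 2 + s * P) / ((P : ℝ) * Q * Real.log P) := by
        have hQne : (Q : ℝ) ≠ 0 := hQ0.ne'
        have hLne : Real.log P ≠ 0 := hLpos.ne'
        have hPne : (P : ℝ) ≠ 0 := hP0.ne'
        field_simp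
      rw [e1, div_le_div_iff₀ (by positivity) (by positivity)]
      nlinarith [mul_le_mul_of_nonneg_right hnum hLpos.le]
    linarith

/-! ### R1c · the main estimate with NO `θ`-hypothesis -/

/-- R2 · **`mertens_prod_lt_of` re-read with NO `θ`-hypothesis** (gen 13): the window was used only for `1 < θ(P)`, which is
`one_lt_theta` (`P ≥ 3`).  For naturals `P ≥ 4¹¹`, `−log f(P) ≤ E` and `E < G₂ + G₁`:
`(∏_{p≤P}(1 − 1/p))⁻¹ · ∏_{Q<p≤P}(1 − 1/p²) < e^γ log(θ(P) + θ(Q))`. -/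
theorem mertens_prod_lt_ofR {P Q : ℕ} {E : ℝ} (hP : 4 ^ 11 ≤ P)
    (hfE : -Real.log (nicolasF P) ≤ E)
    (h3 : E <
      ∑ p ∈ (Nat.primesLE P).filter (fun p => Q < p), ((p : ℝ) ^ 2)⁻¹ +
        θ Q / ((θ P + θ Q) * Real.log (θ P + θ Q))) :
    (∏ p ∈ Nat.primesLE P, (1 - (p : ℝ)⁻¹))⁻¹ *
        ∏ p ∈ (Nat.primesLE P).filter (fun p => Q < p), (1 - ((p : ℝ) ^ 2)⁻¹) <
      rexp eulerMascheroniConstant * Real.log (θ P + θ Q) := by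
  have hPr : (4 : ℝ) ^ 11 ≤ P := by exact_mod_cast hP
  have hP599 : (599 : ℝ) ≤ P := le_trans (by norm_num) hPr
  have hP0 : (0 : ℝ) < P := by linarith
  -- `θ(P) > 1` (no window needed)
  have hθP1 : 1 < θ P := one_lt_theta (le_trans (by norm_num) hP599)
  set S := ∑ p ∈ (Nat.primesLE P).filter (fun p => Q < p), ((p : ℝ) ^ 2)⁻¹ with hSdef
  set R := θ P + θ Q with hR
  set A := Real.log (θ P) with hA
  have hA0 : 0 < A := Real.log_pos hθP1
  have hθQ0 : 0 ≤ θ Q := Chebyshev.theta_nonneg _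
  have hR1 : 1 < R := by linarith
  have hlogR0 : 0 < Real.log R := Real.log_pos hR1
  -- (1) `∏(1-1/p)⁻¹ ≤ e^γ · A · e^E`
  have h1 : (∏ p ∈ Nat.primesLE P, (1 - (p : ℝ)⁻¹))⁻¹ ≤
      rexp eulerMascheroniConstant * A * rexp E := by
    have h := prod_le_of_neg_log_le (x := (P : ℝ)) hP599 hfE
    rwa [Nat.floor_natCast] at h
  -- (2) `∏(1-1/p²) ≤ e^{-S}`
  have h2 : ∏ p ∈ (Nat.primesLE P).filter (fun p => Q < p), (1 - ((p : ℝ) ^ 2)⁻¹) ≤ rexp (-S) := by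
    refine RobinAnalytic.prod_one_sub_le_exp_neg_sum _ _ fun p hp => ?_
    have hp' := Nat.prime_of_mem_primesLE (Finset.mem_filter.1 hp).1
    have : (1 : ℝ) ≤ (p : ℝ) ^ 2 := by
      have : (1 : ℝ) ≤ p := by exact_mod_cast hp'.one_lt.le
      nlinarith
    exact inv_le_one_of_one_le₀ this
  have hPi0 : 0 ≤ ∏ p ∈ (Nat.primesLE P).filter (fun p => Q < p), (1 - ((p : ℝ) ^ 2)⁻¹) :=
    Finset.prod_nonneg fun p hp => by
      have hp' := Nat.prime_of_mem_primesLE (Finset.mem_filter.1 hp).1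
      have : (1 : ℝ) ≤ (p : ℝ) ^ 2 := by
        have : (1 : ℝ) ≤ p := by exact_mod_cast hp'.one_lt.le
        nlinarith
      linarith [inv_le_one_of_one_le₀ this]
  have h4 : θ Q / (R * Real.log R) ≤ Real.log (Real.log R) - Real.log A := by
    have hθPpos : 0 < θ P := by linarith
    have hRA : Real.log R - A = Real.log (R / θ P) := by
      rw [hA, Real.log_div (by linarith) hθPpos.ne']
    have h5 : θ Q / R ≤ Real.log R - A := by
      rw [hRA]
      have := Real.one_sub_inv_le_log_of_pos (x := R / θ P) (by positivity)
      have e1 : 1 - (R / θ P)⁻¹ = θ Q / R := by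
        rw [hR]
        field_simp
        ring
      linarith
    have h6 : (Real.log R - A) / Real.log R ≤ Real.log (Real.log R) - Real.log A := by
      rw [← Real.log_div hlogR0.ne' hA0.ne']
      have := Real.one_sub_inv_le_log_of_pos (x := Real.log R / A) (by positivity)
      have e1 : 1 - (Real.log R / A)⁻¹ = (Real.log R - A) / Real.log R := by
        field_simp
      linarith
    calc θ Q / (R * Real.log R) = θ Q / R / Real.log R := by rw [div_div]
      _ ≤ (Real.log R - A) / Real.log R := div_le_div_of_nonneg_right h5 hlogR0.le
      _ ≤ Real.log (Real.log R) - Real.log A := h6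
  -- (5) `A · exp(E - S) < log R`
  have h7 : A * rexp (E - S) < Real.log R := by
    have h8 : E - S < Real.log (Real.log R) - Real.log A := by linarith [h3, h4]
    have h9 : rexp (E - S) < Real.log R / A := by
      calc rexp (E - S) < rexp (Real.log (Real.log R) - Real.log A) := Real.exp_lt_exp.2 h8
        _ = Real.log R / A := by rw [Real.exp_sub, Real.exp_log hlogR0, Real.exp_log hA0]
    have := mul_lt_mul_of_pos_left h9 hA0
    rwa [mul_div_cancel₀ _ hA0.ne'] at this
  calc (∏ p ∈ Nat.primesLE P, (1 - (p : ℝ)⁻¹))⁻¹ *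
        ∏ p ∈ (Nat.primesLE P).filter (fun p => Q < p), (1 - ((p : ℝ) ^ 2)⁻¹)
      ≤ (rexp eulerMascheroniConstant * A * rexp E) * rexp (-S) := by
        calc _ ≤ (rexp eulerMascheroniConstant * A * rexp E) *
              ∏ p ∈ (Nat.primesLE P).filter (fun p => Q < p), (1 - ((p : ℝ) ^ 2)⁻¹) :=
              mul_le_mul_of_nonneg_right h1 hPi0
          _ ≤ (rexp eulerMascheroniConstant * A * rexp E) * rexp (-S) :=
              mul_le_mul_of_nonneg_left h2 (by positivity)
    _ = rexp eulerMascheroniConstant * (A * rexp (E - S)) := by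
        rw [Real.exp_sub, Real.exp_neg]; ring
    _ < rexp eulerMascheroniConstant * Real.log R :=
        mul_lt_mul_of_pos_left h7 (Real.exp_pos _)

end LargePRel

end Summit.RiemannHypothesis.RiemannHypothesis.Theorems.Splittings.RobinFiniteE3

end
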